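import Mathlib

/-!
# Venture AbcSig — Bézout witnesses over `ℤ[x]` (the kernel-checkable core of the congruence sieve)

HONEST FRAMING. Interface/certificate file of a COMPUTATION cell (`pub-abcsig`, modular-method signature factory
for `A·xⁿ + B·yⁿ = C·z²`). This file proves NO Diophantine statement and makes no claim on ABC or any summit. It
provides the one piece of the pipeline the kernel can check outright: *membership of an integer `r` in an ideal
`(P₁, …, P_m) ⊂ ℤ[x]`*, certified by explicit cofactors `u_i` with `Σ u_i · P_i = r`, and its consequence: every ring
homomorphism `φ : ℤ[x] → R` that kills all `P_i` kills `r`; if `R` has prime characteristic `n ∤ r`, no such `φ` exists.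

In the sieve (see `Sieve/Certificate.lean`) the generators are `F` (the Hecke field polynomial of a newform orbit,
`F(θ) = 0`) and `g_ℓ − d_ℓ·t_ℓ` (`d_ℓ·c_ℓ = g_ℓ(θ)` a certified Hecke eigenvalue, `t_ℓ` a candidate trace of Frobenius);
a witness with `n ∤ r` rules the candidate tuple `(t_ℓ)` out modulo every prime above `n`. All number-field arithmetic
(norms, orders, prime ideals) thereby stays OUTSIDE Lean: the engines find the cofactors by integer linear algebra, the
kernel only re-multiplies integer polynomials.

Contents: little-endian coefficient lists `List ℤ` with `addL / smulL / mulL / isZeroL`, their interpretation `toPoly`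
into Mathlib's `ℤ[X]` with the homomorphism lemmas, `linComb`, the Boolean `bezoutCheck`, and the soundness theorems
`bezout_sound` / `bezout_elim`. Design: lists rather than `Polynomial` so that `decide` evaluates certificates in the
kernel; `toPoly` is the only bridge to Mathlib and is never evaluated.

References: design note `run/shared/lean/pub/pub-abcsig/lead/LEAN-SPEC.md` (cell-internal); the sieve it serves is
Bennett–Skinner, Canad. J. Math. 56 (2004), Prop. 4.3 [BS04].
-/

namespace Summit.Ventures.AbcSig

open Polynomial

/-! ## Little-endian integer coefficient lists -/

/-- Coefficientwise sum of two little-endian coefficient lists (the longer tail is kept). -/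
def addL : List ℤ → List ℤ → List ℤ
  | [], q => q
  | p, [] => p
  | a :: p, b :: q => (a + b) :: addL p q

/-- Scalar multiple of a coefficient list. -/
def smulL (c : ℤ) (p : List ℤ) : List ℤ := p.map (c * ·)

/-- Product of two coefficient lists (schoolbook). -/
def mulL : List ℤ → List ℤ → List ℤ
  | [], _ => []
  | a :: p, q => addL (smulL a q) (0 :: mulL p q)

/-- `true` iff every coefficient is zero (the list may have any length). -/
def isZeroL (p : List ℤ) : Bool := p.all (· == 0)

/-- Interpretation of a little-endian coefficient list as an integer polynomial:
`toPoly [a₀, a₁, …] = a₀ + a₁ X + ⋯`. Never evaluated; it is the bridge to Mathlib's `ℤ[X]`. -/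
noncomputable def toPoly : List ℤ → ℤ[X]
  | [] => 0
  | a :: p => C a + X * toPoly p

/-- `toPoly [] = 0`. -/
@[simp] lemma toPoly_nil : toPoly [] = 0 := rfl

/-- Unfolding `toPoly` on a cons. -/
@[simp] lemma toPoly_cons (a : ℤ) (p : List ℤ) : toPoly (a :: p) = C a + X * toPoly p := rfl

/-- `toPoly` turns `addL` into `+`. -/
lemma toPoly_addL : ∀ p q : List ℤ, toPoly (addL p q) = toPoly p + toPoly q
  | [], q => by simp [addL]
  | a :: p, [] => by simp [addL]
  | a :: p, b :: q => by
      simp only [addL, toPoly_cons, toPoly_addL p q, C_add]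
      ring

/-- `toPoly` turns `smulL c` into multiplication by `C c`. -/
lemma toPoly_smulL (c : ℤ) : ∀ p : List ℤ, toPoly (smulL c p) = C c * toPoly p
  | [] => by simp [smulL]
  | a :: p => by
      have := toPoly_smulL c p
      simp only [smulL, List.map_cons, toPoly_cons] at this ⊢
      rw [this, C_mul]
      ring

/-- `toPoly` turns `mulL` into `*`. -/
lemma toPoly_mulL : ∀ p q : List ℤ, toPoly (mulL p q) = toPoly p * toPoly q
  | [], q => by simp [mulL]
  | a :: p, q => by
      simp only [mulL, toPoly_addL, toPoly_smulL, toPoly_cons, toPoly_mulL p q, C_0, zero_add]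
      ring

/-- A list all of whose coefficients vanish interprets to the zero polynomial. -/
lemma toPoly_eq_zero_of_isZeroL : ∀ p : List ℤ, isZeroL p = true → toPoly p = 0
  | [], _ => rfl
  | a :: p, h => by
      simp only [isZeroL, List.all_cons, Bool.and_eq_true, beq_iff_eq] at h
      obtain ⟨ha, hp⟩ := h
      have := toPoly_eq_zero_of_isZeroL p (by simpa [isZeroL] using hp)
      simp [ha, this]

/-- The constant list `[r]` interprets to `C r`. -/
@[simp] lemma toPoly_singleton (r : ℤ) : toPoly [r] = C r := by simp

/-! ## Bézout witnesses: `r ∈ (P₁, …, P_m) ⊂ ℤ[x]` -/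

/-- `linComb us Ps = Σ_i us[i] · Ps[i]` as a coefficient list (extra entries of the longer list are ignored). -/
def linComb : List (List ℤ) → List (List ℤ) → List ℤ
  | u :: us, P :: Ps => addL (mulL u P) (linComb us Ps)
  | _, _ => []

/-- A ring homomorphism out of `ℤ[X]` that kills every generator kills every `linComb` of them. -/
lemma map_toPoly_linComb_eq_zero {R : Type*} [CommRing R] (φ : ℤ[X] →+* R) :
    ∀ (us Ps : List (List ℤ)), (∀ P ∈ Ps, φ (toPoly P) = 0) → φ (toPoly (linComb us Ps)) = 0
  | [], [], _ => by simp [linComb]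
  | [], _ :: _, _ => by simp [linComb]
  | _ :: _, [], _ => by simp [linComb]
  | u :: us, P :: Ps, h => by
      have hP : φ (toPoly P) = 0 := h P (by simp)
      have hrest := map_toPoly_linComb_eq_zero φ us Ps (fun Q hQ => h Q (by simp [hQ]))
      simp [linComb, toPoly_addL, toPoly_mulL, map_add, map_mul, hP, hrest]

/-- **Bézout check** (computable): the cofactors `us` certify `r ∈ (Ps)`, i.e. `Σ us[i]·Ps[i] − r` has all
coefficients zero. This is what `decide` evaluates. -/
def bezoutCheck (Ps : List (List ℤ)) (us : List (List ℤ)) (r : ℤ) : Bool :=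
  isZeroL (addL (linComb us Ps) [-r])

/-- **Soundness of a Bézout witness.** If `bezoutCheck Ps us r` holds then every ring homomorphism
`φ : ℤ[X] →+* R` into a commutative ring with `φ(P) = 0` for all `P ∈ Ps` satisfies `(r : R) = 0`. -/
theorem bezout_sound {Ps us : List (List ℤ)} {r : ℤ} (h : bezoutCheck Ps us r = true)
    {R : Type*} [CommRing R] (φ : ℤ[X] →+* R) (hP : ∀ P ∈ Ps, φ (toPoly P) = 0) : (r : R) = 0 := by
  have h0 := toPoly_eq_zero_of_isZeroL _ h
  rw [toPoly_addL, toPoly_singleton, C_neg] at h0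
  have h1 := congrArg φ h0
  rw [map_add, map_toPoly_linComb_eq_zero φ us Ps hP, map_neg, map_zero, zero_add, neg_eq_zero] at h1
  simpa using h1

/-- **Elimination in characteristic `n`.** If `bezoutCheck Ps us r` holds and `n ∤ r`, there is no ring homomorphism
`ℤ[X] → R` into a commutative ring of characteristic `n` killing all of `Ps`. (For the sieve: `R` = residue field of
a prime above `n`, `Ps = [F, g_ℓ − d_ℓ t_ℓ, …]`.) -/
theorem bezout_elim {Ps us : List (List ℤ)} {r : ℤ} (h : bezoutCheck Ps us r = true) (n : ℕ)
    (hn : ¬ n ∣ r.natAbs) {R : Type*} [CommRing R] [CharP R n] (φ : ℤ[X] →+* R)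
    (hP : ∀ P ∈ Ps, φ (toPoly P) = 0) : False := by
  have hr : (r : R) = 0 := bezout_sound h φ hP
  rw [CharP.intCast_eq_zero_iff R n, Int.natCast_dvd] at hr
  exact hn hr

/-! ## Toy instance (level 578, an orbit with `F = x² − 2`, `c₃ = θ`, candidate trace `t = 0`):
`(−1)·(x² − 2) + x·(x − 0) = 2`, so only `n = 2` can survive this candidate. -/

/-- Toy check: `2 ∈ (x² − 2, x)`, evaluated by the kernel. -/
example : bezoutCheck [[-2, 0, 1], [0, 1]] [[-1], [0, 1]] 2 = true := by decide

end Summit.Ventures.AbcSig
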